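import Literature.NumberTheory.Transcendental.GammaIsoTwisted
import HarnessLib

/-!
# Γ-isomorphisms between tuples in two exponential fields ("cross" Γ-isomorphisms)

M. Bays, J. Kirby, *Pseudo-exponential maps, variants, and quasiminimality*, Algebra & Number
Theory 12 (2018), Def. 3.10 (embeddings/isomorphisms of Γ-fields), Def. 5.14 (`ℵ₀`-saturation
for Γ-algebraic extensions: an *abstract* extension `B` of `A ⊆ F` embeds into `F` over `A`),
and Thm 8.2 / Thm 9.1 (categoricity); L. Haykazyan, *Categoricity in quasiminimal pregeometry
classes*, J. Symbolic Logic 81 (2016), Def. 2 (partial embeddings BETWEEN two members of a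
class). The tree's Γ-field algebra (`GammaFields.lean`, `ZilberSaturation.lean`:
`GammaField.IsGammaIso K c c'`; `GammaIsoTwisted.lean`: `GammaField.IsGammaIsoTw σ c c'` over an
isomorphism `σ` of two bases `K₁, K₂ ≤ F`) lives inside ONE exponential field `F`, and so do the
tree's `ℵ₀`-saturation theorems (`BaysKirby2018_saturation_of_isStronglyExpAlgClosed_holds`,
`GammaField.isGammaIsoTw_saturation`): the extension to be embedded is presented by a tuple of
the same field. Zilber's categoricity theorem (`zilber_categoricity`, `ZilberField.lean`)
compares two fields, and every route to it (Bays–Kirby Thm 8.2 via the quasiminimal class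
`𝒦(M)`; Haykazyan's Thm 16 via `Literature.ModelTheory.Quasiminimal.IsQuasiminimalPregeometryClass`)
needs the Γ-isomorphisms and the saturation theorem with source and target in DIFFERENT fields.

This file is the first of that cross-field port: the vocabulary. For exponential fields `F₁`,
`F₂` (same universe), bases `K₁ ≤ F₁`, `K₂ ≤ F₂` (`ℚ`-subspaces) and a ring isomorphism
`σ : K₁⁰ ≃+* K₂⁰` of their Γ-fields (`GammaField.fieldOf`):

* `GammaField.IsEBaseIso₂ K₁ K₂ σ` — `σ` is an isomorphism of base Γ-fields (`σ(K₁) = K₂`,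
  `σ ∘ exp = exp ∘ σ` on `K₁`);
* `GammaField.IsGammaIsoTw₂ σ c c'` for `c : Fin N → F₁`, `c' : Fin N → F₂` — **`c ↦ c'` is an
  isomorphism of Γ-fields `⟨K₁ c⟩ ≅ ⟨K₂ c'⟩ over `σ`**: at every level `M`, a polynomial over
  `K₁⁰` vanishes at `(c, exp (c/M!))` iff its `σ`-transport vanishes at `(c', exp (c'/M!))`.
  For `F₁ = F₂` this is the tree's `IsGammaIsoTw` by `Iff.rfl` (`isGammaIsoTw₂_iff_isGammaIsoTw`);
* the groupoid structure (`symm`, composition with one-field Γ-isomorphisms on either side,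
  `isGammaIso_of_left/right`, restriction `comp`, coincidences, base constants);
* **faithfulness**: the glued field isomorphism
  `IsGammaIsoTw₂.fieldEquiv : K₁⁰(allGens c) ≃+* K₂⁰(allGens c')` (a subfield of `F₁` onto a
  subfield of `F₂`) extending `σ` with `lvGens M c ↦ lvGens M c'`, an isomorphism of Γ-fields
  when `σ` is (`fieldEquiv_exp`), the converse `isGammaIsoTw₂_of_ringHom`, the summary
  `isGammaIsoTw₂_iff_exists_ringEquiv`, and uniqueness `ringHom_eq_fieldEquiv`.

All proofs are those of `GammaIsoTwisted.lean`, verbatim with the two fields kept apart;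
everything is proved and elementary.

## References

* M. Bays, J. Kirby, *Pseudo-exponential maps, variants, and quasiminimality*, Algebra & Number
  Theory 12 (2018) 493–549: Def. 3.8, Def. 3.10, Def. 3.15, Def. 5.2, Def. 5.14, Thm 8.2.
* L. Haykazyan, *Categoricity in quasiminimal pregeometry classes*, J. Symbolic Logic 81 (2016)
  56–64: Def. 2.
* J. Kirby, *On quasiminimal excellent classes*, J. Symbolic Logic 75 (2010) 551–564: Thm 2.1.
-/

noncomputable section

open Set

universe u

namespace Literature.NumberTheory.Transcendental

namespace GammaField

open Literature.ModelTheory.ExponentialFields.ExponentialRing ZilberHomogeneity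

variable {F₁ : Type u} [Field F₁] [CharZero F₁] [Literature.ModelTheory.ExponentialFields.ExponentialRing F₁]
variable {F₂ : Type u} [Field F₂] [CharZero F₂] [Literature.ModelTheory.ExponentialFields.ExponentialRing F₂]
variable {F₃ : Type u} [Field F₃] [CharZero F₃] [Literature.ModelTheory.ExponentialFields.ExponentialRing F₃]

/-! ### Isomorphisms of base Γ-fields in two fields -/

/-- **`σ : ℚ(K₁, exp K₁) ≃ ℚ(K₂, exp K₂)` is an isomorphism of Γ-fields**, for `ℚ`-subspaces
`K₁ ≤ F₁`, `K₂ ≤ F₂` of two exponential fields (Bays–Kirby 2018, Def. 3.10; the cross-field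
form of `GammaField.IsEBaseIso`): `σ` maps `K₁` onto `K₂` and `σ (exp x) = exp (σ x)` for
`x ∈ K₁`. [cite: BaysKirby2018ANT, Def. 3.10] -/
structure IsEBaseIso₂ (K₁ : Submodule ℚ F₁) (K₂ : Submodule ℚ F₂) (σ : fieldOf K₁ ≃+* fieldOf K₂) :
    Prop where
  /-- `σ(K₁) ⊆ K₂`. -/
  map_mem : ∀ {x : F₁} (hx : x ∈ K₁), (σ ⟨x, mem_fieldOf_of_mem hx⟩ : F₂) ∈ K₂
  /-- `σ⁻¹(K₂) ⊆ K₁`. -/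
  symm_map_mem : ∀ {y : F₂} (hy : y ∈ K₂), (σ.symm ⟨y, mem_fieldOf_of_mem hy⟩ : F₁) ∈ K₁
  /-- `σ` commutes with `exp` on `K₁`. -/
  map_exp : ∀ {x : F₁} (hx : x ∈ K₁),
    (σ ⟨exp x, exp_mem_fieldOf hx⟩ : F₂) = exp (σ ⟨x, mem_fieldOf_of_mem hx⟩ : F₂)

/-- Inside one field, `IsEBaseIso₂` is `IsEBaseIso`. [folklore] -/
theorem isEBaseIso₂_iff_isEBaseIso {K₁ K₂ : Submodule ℚ F₁} {σ : fieldOf K₁ ≃+* fieldOf K₂} :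
    IsEBaseIso₂ K₁ K₂ σ ↔ IsEBaseIso K₁ K₂ σ :=
  ⟨fun h => ⟨h.map_mem, h.symm_map_mem, h.map_exp⟩, fun h => ⟨h.map_mem, h.symm_map_mem, h.map_exp⟩⟩

namespace IsEBaseIso₂

variable {K₁ : Submodule ℚ F₁} {K₂ : Submodule ℚ F₂} {σ : fieldOf K₁ ≃+* fieldOf K₂}

/-- The identity is an isomorphism of base Γ-fields. [folklore] -/
theorem refl (K : Submodule ℚ F₁) : IsEBaseIso₂ K K (RingEquiv.refl _) where
  map_mem hx := hx
  symm_map_mem hy := hy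
  map_exp _ := rfl

/-- The inverse of an isomorphism of base Γ-fields is one. [folklore] -/
theorem symm (h : IsEBaseIso₂ K₁ K₂ σ) : IsEBaseIso₂ K₂ K₁ σ.symm where
  map_mem hy := h.symm_map_mem hy
  symm_map_mem hx := by rw [RingEquiv.symm_symm]; exact h.map_mem hx
  map_exp {y} hy := by
    have hx : (σ.symm ⟨y, mem_fieldOf_of_mem hy⟩ : F₁) ∈ K₁ := h.symm_map_mem hy
    have h1 := h.map_exp hx
    have e1 : (⟨(σ.symm ⟨y, mem_fieldOf_of_mem hy⟩ : F₁), mem_fieldOf_of_mem hx⟩ : fieldOf K₁) =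
        σ.symm ⟨y, mem_fieldOf_of_mem hy⟩ := Subtype.ext rfl
    rw [e1, RingEquiv.apply_symm_apply] at h1
    have e2 : (⟨exp y, exp_mem_fieldOf hy⟩ : fieldOf K₂) =
        σ ⟨exp (σ.symm ⟨y, mem_fieldOf_of_mem hy⟩ : F₁), exp_mem_fieldOf hx⟩ :=
      Subtype.ext h1.symm
    rw [e2, RingEquiv.symm_apply_apply]

/-- `σ x ∈ K₂` for `x ∈ K₁`, membership proof irrelevant. [folklore] -/
theorem coe_map_mem (h : IsEBaseIso₂ K₁ K₂ σ) {x : F₁} (hx : x ∈ K₁) (hx' : x ∈ fieldOf K₁) :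
    (σ ⟨x, hx'⟩ : F₂) ∈ K₂ :=
  h.map_mem hx

/-- `σ (exp x) = exp (σ x)` for `x ∈ K₁`, membership proofs irrelevant. [folklore] -/
theorem coe_map_exp (h : IsEBaseIso₂ K₁ K₂ σ) {x : F₁} (hx : x ∈ K₁) (hx' : x ∈ fieldOf K₁)
    (hex : exp x ∈ fieldOf K₁) : (σ ⟨exp x, hex⟩ : F₂) = exp (σ ⟨x, hx'⟩ : F₂) :=
  h.map_exp hx

end IsEBaseIso₂

/-! ### Cross Γ-isomorphisms over a base isomorphism -/

/-- **`c ↦ c'` is an isomorphism of Γ-fields `⟨K₁ c⟩ ≅ ⟨K₂ c'⟩ over the base isomorphism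
`σ : K₁⁰ ≃ K₂⁰`, for tuples `c` in `F₁` and `c'` in `F₂`** (Bays–Kirby 2018, Def. 3.10; the
cross-field form of `GammaField.IsGammaIsoTw`): for every level `M`, a polynomial `P` over
`K₁⁰` vanishes at the level-`M` generators `(c, exp (c/M!))` iff its `σ`-transport `P^σ`
vanishes at `(c', exp (c'/M!))`. Equivalent to the existence of a field isomorphism
`⟨K₁ c⟩ ≅ ⟨K₂ c'⟩` extending `σ` with `lvGens M c ↦ lvGens M c'`
(`isGammaIsoTw₂_iff_exists_ringEquiv`). [cite: BaysKirby2018ANT, Def. 3.10, Def. 5.14] -/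
def IsGammaIsoTw₂ {K₁ : Submodule ℚ F₁} {K₂ : Submodule ℚ F₂} (σ : fieldOf K₁ ≃+* fieldOf K₂)
    {N : ℕ} (c : Fin N → F₁) (c' : Fin N → F₂) : Prop :=
  ∀ (M : ℕ) (P : MvPolynomial (Fin N ⊕ Fin N) (fieldOf K₁)),
    MvPolynomial.aeval (lvGens M c) P = 0 ↔
      MvPolynomial.aeval (lvGens M c') (MvPolynomial.map (σ : fieldOf K₁ →+* fieldOf K₂) P) = 0

/-- Inside one field, `IsGammaIsoTw₂` is `IsGammaIsoTw` (by `Iff.rfl`). [folklore] -/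
theorem isGammaIsoTw₂_iff_isGammaIsoTw {K₁ K₂ : Submodule ℚ F₁} {σ : fieldOf K₁ ≃+* fieldOf K₂}
    {N : ℕ} {c c' : Fin N → F₁} : IsGammaIsoTw₂ σ c c' ↔ IsGammaIsoTw σ c c' :=
  Iff.rfl

section Basic

variable {K₁ : Submodule ℚ F₁} {K₂ : Submodule ℚ F₂} {K₃ : Submodule ℚ F₃}
  {σ : fieldOf K₁ ≃+* fieldOf K₂} {N : ℕ} {c : Fin N → F₁} {c' c'' : Fin N → F₂}

/-- Reflexivity over the identity (one field). [folklore] -/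
theorem IsGammaIsoTw₂.refl (K : Submodule ℚ F₁) (c : Fin N → F₁) :
    IsGammaIsoTw₂ (RingEquiv.refl (fieldOf K)) c c :=
  isGammaIsoTw₂_iff_isGammaIsoTw.2 (IsGammaIsoTw.refl K c)

/-- **Symmetry**: the inverse of a Γ-isomorphism over `σ` is one over `σ⁻¹`. [folklore] -/
theorem IsGammaIsoTw₂.symm (h : IsGammaIsoTw₂ σ c c') : IsGammaIsoTw₂ σ.symm c' c := by
  intro M Q
  have := h M (MvPolynomial.map (σ.symm : fieldOf K₂ →+* fieldOf K₁) Q)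
  rw [map_map_symm] at this
  exact this.symm

/-- **Transitivity across three fields.** [folklore] -/
theorem IsGammaIsoTw₂.trans₂ {τ : fieldOf K₂ ≃+* fieldOf K₃} {c₃ : Fin N → F₃}
    (h : IsGammaIsoTw₂ σ c c') (h' : IsGammaIsoTw₂ τ c' c₃) :
    IsGammaIsoTw₂ (σ.trans τ) c c₃ := by
  intro M P
  have h1 := h M P
  have h2 := h' M (MvPolynomial.map (σ : fieldOf K₁ →+* fieldOf K₂) P)
  rw [MvPolynomial.map_map] at h2
  exact h1.trans h2

/-- **Composition with a Γ-isomorphism over `K₂` on the right.** [folklore] -/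
theorem IsGammaIsoTw₂.trans (h : IsGammaIsoTw₂ σ c c') (h' : IsGammaIso K₂ c' c'') :
    IsGammaIsoTw₂ σ c c'' := fun M P =>
  (h M P).trans (h'.aeval_eq_zero_iff M _)

/-- **Composition with a Γ-isomorphism over `K₁` on the left.** [folklore] -/
theorem _root_.Literature.NumberTheory.Transcendental.GammaField.IsGammaIso.trans_tw₂
    {c₀ : Fin N → F₁} (h : IsGammaIso K₁ c₀ c) (h' : IsGammaIsoTw₂ σ c c') :
    IsGammaIsoTw₂ σ c₀ c' := fun M P =>
  (h.aeval_eq_zero_iff M P).trans (h' M P)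

/-- **Two Γ-isomorphisms over the same `σ` with the same source differ by a Γ-isomorphism
over `K₂`.** [folklore] -/
theorem IsGammaIsoTw₂.isGammaIso_of_left (h : IsGammaIsoTw₂ σ c c') (h' : IsGammaIsoTw₂ σ c c'') :
    IsGammaIso K₂ c' c'' := by
  rw [isGammaIso_iff_ker_eq]
  intro M
  ext Q
  rw [RingHom.mem_ker, RingHom.mem_ker]
  have h1 := h.symm M Q
  have h2 := h' M (MvPolynomial.map (σ.symm : fieldOf K₂ →+* fieldOf K₁) Q)
  rw [map_map_symm] at h2
  exact h1.trans h2

/-- **Two Γ-isomorphisms over the same `σ` with the same target differ by a Γ-isomorphism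
over `K₁`.** [folklore] -/
theorem IsGammaIsoTw₂.isGammaIso_of_right {c₀ : Fin N → F₁} (h : IsGammaIsoTw₂ σ c c')
    (h' : IsGammaIsoTw₂ σ c₀ c') : IsGammaIso K₁ c c₀ := by
  have := h.symm.isGammaIso_of_left h'.symm
  exact this

/-- **Restriction to sub-tuples / re-indexing.** [folklore] -/
theorem IsGammaIsoTw₂.comp (h : IsGammaIsoTw₂ σ c c') {m : ℕ} (ρ : Fin m → Fin N) :
    IsGammaIsoTw₂ σ (c ∘ ρ) (c' ∘ ρ) := by
  intro M P
  have e1 : MvPolynomial.aeval (lvGens M (c ∘ ρ)) P =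
      MvPolynomial.aeval (lvGens M c) (MvPolynomial.rename (Sum.map ρ ρ) P) := by
    rw [MvPolynomial.aeval_rename, lvGens_comp']
  have e2 : MvPolynomial.aeval (lvGens M (c' ∘ ρ))
        (MvPolynomial.map (σ : fieldOf K₁ →+* fieldOf K₂) P) =
      MvPolynomial.aeval (lvGens M c') (MvPolynomial.rename (Sum.map ρ ρ)
        (MvPolynomial.map (σ : fieldOf K₁ →+* fieldOf K₂) P)) := by
    rw [MvPolynomial.aeval_rename, lvGens_comp']
  rw [e1, e2, ← MvPolynomial.map_rename]
  exact h M _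

/-- Related tuples have the same pattern of equal coordinates. [folklore] -/
theorem IsGammaIsoTw₂.apply_eq_iff (h : IsGammaIsoTw₂ σ c c') (i j : Fin N) :
    c i = c j ↔ c' i = c' j := by
  have := h 0 (MvPolynomial.X (Sum.inl i) - MvPolynomial.X (Sum.inl j))
  simpa [sub_eq_zero] using this

/-- **Base constants are carried along `σ`**: if `cᵢ = k ∈ K₁⁰` then `c'ᵢ = σ k`. [folklore] -/
theorem IsGammaIsoTw₂.eq_of_eq_coe (h : IsGammaIsoTw₂ σ c c') {i : Fin N} {k : fieldOf K₁}
    (hk : c i = k) : c' i = σ k := by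
  have := h 0 (MvPolynomial.X (Sum.inl i) - MvPolynomial.C k)
  simp only [map_sub, MvPolynomial.aeval_X, lvGens_inl, MvPolynomial.aeval_C, MvPolynomial.map_X,
    MvPolynomial.map_C, sub_eq_zero] at this
  exact this.1 hk

/-- Conversely, if `c'ᵢ = σ k` then `cᵢ = k`. [folklore] -/
theorem IsGammaIsoTw₂.eq_coe_of_eq (h : IsGammaIsoTw₂ σ c c') {i : Fin N} {k : fieldOf K₁}
    (hk : c' i = σ k) : c i = k := by
  have := h.symm.eq_of_eq_coe (k := σ k) hk
  rwa [RingEquiv.symm_apply_apply] at this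

/-- The exponential coordinates: if `exp (cᵢ / M!) = k ∈ K₁⁰` then `exp (c'ᵢ / M!) = σ k`.
[folklore] -/
theorem IsGammaIsoTw₂.exp_eq_of_exp_eq_coe (h : IsGammaIsoTw₂ σ c c') (M : ℕ) {i : Fin N}
    {k : fieldOf K₁} (hk : exp (c i / (M.factorial : F₁)) = k) :
    exp (c' i / (M.factorial : F₂)) = σ k := by
  have := h M (MvPolynomial.X (Sum.inr i) - MvPolynomial.C k)
  simp only [map_sub, MvPolynomial.aeval_X, lvGens_inr, MvPolynomial.aeval_C, MvPolynomial.map_X,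
    MvPolynomial.map_C, sub_eq_zero] at this
  exact this.1 hk

end Basic

/-! ## Faithfulness: the field isomorphism `⟨K₁ c⟩ ≅ ⟨K₂ c'⟩` over `σ`, across the fields -/

section Faithfulness

variable {K₁ : Submodule ℚ F₁} {K₂ : Submodule ℚ F₂} {σ : fieldOf K₁ ≃+* fieldOf K₂} {N : ℕ}
  {c : Fin N → F₁} {c' : Fin N → F₂}

/-- Related tuples satisfy corresponding relations *across levels*: if
`P(lvGens M c) = Q(lvGens M' c)` then `P^σ(lvGens M c') = Q^σ(lvGens M' c')`. [folklore] -/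
theorem IsGammaIsoTw₂.aeval_eq_aeval (h : IsGammaIsoTw₂ σ c c') {M M' : ℕ}
    (P Q : MvPolynomial (Fin N ⊕ Fin N) (fieldOf K₁))
    (hPQ : MvPolynomial.aeval (lvGens M c) P = MvPolynomial.aeval (lvGens M' c) Q) :
    MvPolynomial.aeval (lvGens M c') (MvPolynomial.map (σ : fieldOf K₁ →+* fieldOf K₂) P) =
      MvPolynomial.aeval (lvGens M' c') (MvPolynomial.map (σ : fieldOf K₁ →+* fieldOf K₂) Q) := by
  set L := max M M'
  have hM : M ≤ L := le_max_left _ _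
  have hM' : M' ≤ L := le_max_right _ _
  have h1 : MvPolynomial.aeval (lvGens L c) (lvSubst _ N M L P - lvSubst _ N M' L Q) = 0 := by
    rw [map_sub, aeval_lvSubst hM, aeval_lvSubst hM', hPQ, sub_self]
  have h2 := (h L _).1 h1
  rw [map_sub, map_lvSubst, map_lvSubst, map_sub, aeval_lvSubst hM, aeval_lvSubst hM',
    sub_eq_zero] at h2
  exact h2

/-! ### The glued homomorphism on `K₁⁰[allGens c]` -/

/-- The value of the glued homomorphism at `x ∈ K₁⁰[allGens c]`: write `x = P(lvGens M c)` for
some level `M` and polynomial `P` over `K₁⁰` (choice) and take `P^σ(lvGens M c') ∈ F₂`.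
[folklore] -/
def IsGammaIsoTw₂.adjoinFun (_h : IsGammaIsoTw₂ σ c c')
    (x : Algebra.adjoin (fieldOf K₁) (allGens c)) : F₂ :=
  MvPolynomial.aeval (lvGens (exists_mem_lvAlgebra_of_mem_adjoin_allGens x.2).choose c')
    (MvPolynomial.map (σ : fieldOf K₁ →+* fieldOf K₂)
      (exists_aeval_eq_of_mem_lvAlgebra
        (exists_mem_lvAlgebra_of_mem_adjoin_allGens x.2).choose_spec).choose)

/-- **Well-definedness**: `adjoinFun x = P^σ(lvGens M c')` for ANY presentation
`x = P(lvGens M c)`. [folklore] -/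
theorem IsGammaIsoTw₂.adjoinFun_eq (h : IsGammaIsoTw₂ σ c c')
    (x : Algebra.adjoin (fieldOf K₁) (allGens c)) {M : ℕ}
    {P : MvPolynomial (Fin N ⊕ Fin N) (fieldOf K₁)} (hP : MvPolynomial.aeval (lvGens M c) P = x) :
    h.adjoinFun x =
      MvPolynomial.aeval (lvGens M c') (MvPolynomial.map (σ : fieldOf K₁ →+* fieldOf K₂) P) := by
  unfold IsGammaIsoTw₂.adjoinFun
  refine h.aeval_eq_aeval _ _ ?_
  rw [(exists_aeval_eq_of_mem_lvAlgebra
    (exists_mem_lvAlgebra_of_mem_adjoin_allGens x.2).choose_spec).choose_spec, hP]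

/-- **The glued homomorphism `θ₀ : K₁⁰[allGens c] → F₂`**, `P(lvGens M c) ↦ P^σ(lvGens M c')`.
[folklore] -/
def IsGammaIsoTw₂.adjoinHom (h : IsGammaIsoTw₂ σ c c') :
    Algebra.adjoin (fieldOf K₁) (allGens c) →+* F₂ where
  toFun := h.adjoinFun
  map_one' := by
    rw [h.adjoinFun_eq 1 (M := 0) (P := 1) (by simp)]
    simp
  map_mul' x y := by
    obtain ⟨M, P, Q, hP, hQ⟩ := exists_level_aeval_eq₂ x y
    rw [h.adjoinFun_eq x hP, h.adjoinFun_eq y hQ,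
      h.adjoinFun_eq (x * y) (M := M) (P := P * Q) (by rw [map_mul, hP, hQ]; rfl)]
    simp
  map_zero' := by
    rw [h.adjoinFun_eq 0 (M := 0) (P := 0) (by simp)]
    simp
  map_add' x y := by
    obtain ⟨M, P, Q, hP, hQ⟩ := exists_level_aeval_eq₂ x y
    rw [h.adjoinFun_eq x hP, h.adjoinFun_eq y hQ,
      h.adjoinFun_eq (x + y) (M := M) (P := P + Q) (by rw [map_add, hP, hQ]; rfl)]
    simp

/-- `θ₀ (P(lvGens M c)) = P^σ(lvGens M c')`. [folklore] -/
theorem IsGammaIsoTw₂.adjoinHom_aeval (h : IsGammaIsoTw₂ σ c c') (M : ℕ)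
    (P : MvPolynomial (Fin N ⊕ Fin N) (fieldOf K₁)) :
    h.adjoinHom ⟨MvPolynomial.aeval (lvGens M c) P,
        lvAlgebra_le_adjoin_allGens K₁ M c (aeval_mem_adjoin_range _ P)⟩ =
      MvPolynomial.aeval (lvGens M c') (MvPolynomial.map (σ : fieldOf K₁ →+* fieldOf K₂) P) :=
  h.adjoinFun_eq _ rfl

/-- `θ₀` maps generators to generators: `θ₀ (lvGens M c j) = lvGens M c' j`. [folklore] -/
theorem IsGammaIsoTw₂.adjoinHom_lvGens (h : IsGammaIsoTw₂ σ c c') (M : ℕ) (j : Fin N ⊕ Fin N) :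
    h.adjoinHom ⟨lvGens M c j, lvAlgebra_le_adjoin_allGens K₁ M c (lvGens_mem_lvAlgebra K₁ M c j)⟩ =
      lvGens M c' j := by
  have := h.adjoinHom_aeval M (MvPolynomial.X j)
  simp only [MvPolynomial.aeval_X, MvPolynomial.map_X] at this
  rw [← this]

/-- **`θ₀` extends `σ`**: `θ₀ k = σ k` for `k ∈ K₁⁰`. [folklore] -/
theorem IsGammaIsoTw₂.adjoinHom_algebraMap (h : IsGammaIsoTw₂ σ c c') (k : fieldOf K₁) :
    h.adjoinHom ⟨k, (Algebra.adjoin (fieldOf K₁) (allGens c)).algebraMap_mem k⟩ = σ k := by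
  have := h.adjoinHom_aeval 0 (MvPolynomial.C k)
  simp only [MvPolynomial.aeval_C, MvPolynomial.map_C] at this
  exact this

/-- `θ₀` is injective. [folklore] -/
theorem IsGammaIsoTw₂.adjoinHom_injective (h : IsGammaIsoTw₂ σ c c') :
    Function.Injective h.adjoinHom := by
  rw [injective_iff_map_eq_zero]
  intro x hx
  obtain ⟨M, P, hP⟩ := exists_level_aeval_eq x
  have ex : x = ⟨MvPolynomial.aeval (lvGens M c) P,
      lvAlgebra_le_adjoin_allGens K₁ M c (aeval_mem_adjoin_range _ P)⟩ := Subtype.ext hP.symm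
  rw [ex, h.adjoinHom_aeval] at hx
  rw [ex]
  exact Subtype.ext ((h M P).2 hx)

/-- The range of `θ₀` is `K₂⁰[allGens c']`. [folklore] -/
theorem IsGammaIsoTw₂.range_adjoinHom (h : IsGammaIsoTw₂ σ c c') :
    h.adjoinHom.range = (Algebra.adjoin (fieldOf K₂) (allGens c')).toSubring := by
  apply le_antisymm
  · rintro _ ⟨x, rfl⟩
    obtain ⟨M, P, hP⟩ := exists_level_aeval_eq x
    have ex : x = ⟨MvPolynomial.aeval (lvGens M c) P,
        lvAlgebra_le_adjoin_allGens K₁ M c (aeval_mem_adjoin_range _ P)⟩ := Subtype.ext hP.symm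
    rw [ex, h.adjoinHom_aeval]
    exact lvAlgebra_le_adjoin_allGens K₂ M c' (aeval_mem_adjoin_range _ _)
  · intro y hy
    obtain ⟨M, hM⟩ := exists_mem_lvAlgebra_of_mem_adjoin_allGens (K := K₂) hy
    obtain ⟨Q, hQ⟩ := exists_aeval_eq_of_mem_lvAlgebra hM
    refine ⟨⟨MvPolynomial.aeval (lvGens M c) (MvPolynomial.map (σ.symm : fieldOf K₂ →+* fieldOf K₁) Q),
      lvAlgebra_le_adjoin_allGens K₁ M c (aeval_mem_adjoin_range _ _)⟩, ?_⟩
    rw [h.adjoinHom_aeval, map_map_symm, hQ]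

/-- **The isomorphism of generated algebras** `θ₁ : K₁⁰[allGens c] ≃+* K₂⁰[allGens c']` over
`σ`, across the two fields. [folklore] -/
def IsGammaIsoTw₂.adjoinEquiv (h : IsGammaIsoTw₂ σ c c') :
    Algebra.adjoin (fieldOf K₁) (allGens c) ≃+* Algebra.adjoin (fieldOf K₂) (allGens c') :=
  (RingEquiv.ofBijective h.adjoinHom.rangeRestrict
      ⟨fun _ _ hxy => h.adjoinHom_injective (Subtype.ext_iff.1 hxy),
        h.adjoinHom.rangeRestrict_surjective⟩).trans
    (RingEquiv.subringCongr h.range_adjoinHom)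

/-- `θ₁` is `θ₀` on underlying elements. [folklore] -/
@[simp] theorem IsGammaIsoTw₂.coe_adjoinEquiv (h : IsGammaIsoTw₂ σ c c')
    (x : Algebra.adjoin (fieldOf K₁) (allGens c)) : (h.adjoinEquiv x : F₂) = h.adjoinHom x := rfl

/-! ### Extension to the generated fields -/

open scoped IntermediateField.algebraAdjoinAdjoin

/-- **The isomorphism of generated fields** `θ : K₁⁰(allGens c) ≃+* K₂⁰(allGens c')` over `σ`
attached to a cross Γ-isomorphism: the extension of `θ₁` to fraction fields — a subfield of
`F₁` onto a subfield of `F₂`. [folklore] -/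
def IsGammaIsoTw₂.fieldEquiv (h : IsGammaIsoTw₂ σ c c') :
    IntermediateField.adjoin (fieldOf K₁) (allGens c) ≃+*
      IntermediateField.adjoin (fieldOf K₂) (allGens c') :=
  IsFractionRing.ringEquivOfRingEquiv
    (A := Algebra.adjoin (fieldOf K₁) (allGens c))
    (B := Algebra.adjoin (fieldOf K₂) (allGens c'))
    h.adjoinEquiv

/-- `θ` extends `θ₀`. [folklore] -/
theorem IsGammaIsoTw₂.coe_fieldEquiv_of_mem (h : IsGammaIsoTw₂ σ c c') {x : F₁}
    (hx : x ∈ Algebra.adjoin (fieldOf K₁) (allGens c)) :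
    (h.fieldEquiv ⟨x, mem_adjoinField_of_mem_adjoin hx⟩ : F₂) = h.adjoinHom ⟨x, hx⟩ := by
  have := IsFractionRing.ringEquivOfRingEquiv_algebraMap
    (A := Algebra.adjoin (fieldOf K₁) (allGens c))
    (K := IntermediateField.adjoin (fieldOf K₁) (allGens c))
    (B := Algebra.adjoin (fieldOf K₂) (allGens c'))
    (L := IntermediateField.adjoin (fieldOf K₂) (allGens c'))
    h.adjoinEquiv ⟨x, hx⟩
  have h1 : (algebraMap (Algebra.adjoin (fieldOf K₁) (allGens c))
      (IntermediateField.adjoin (fieldOf K₁) (allGens c)) ⟨x, hx⟩) =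
      ⟨x, mem_adjoinField_of_mem_adjoin hx⟩ := rfl
  rw [h1] at this
  unfold IsGammaIsoTw₂.fieldEquiv
  rw [this]
  rfl

/-- **`θ` extends `σ`.** [folklore] -/
theorem IsGammaIsoTw₂.coe_fieldEquiv_algebraMap (h : IsGammaIsoTw₂ σ c c') (k : fieldOf K₁) :
    (h.fieldEquiv ⟨k, (IntermediateField.adjoin (fieldOf K₁) (allGens c)).algebraMap_mem k⟩ : F₂) =
      σ k := by
  have hk : (k : F₁) ∈ Algebra.adjoin (fieldOf K₁) (allGens c) :=
    (Algebra.adjoin (fieldOf K₁) (allGens c)).algebraMap_mem k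
  have := h.coe_fieldEquiv_of_mem hk
  rw [show (⟨k, mem_adjoinField_of_mem_adjoin hk⟩ :
      IntermediateField.adjoin (fieldOf K₁) (allGens c)) =
    ⟨k, (IntermediateField.adjoin (fieldOf K₁) (allGens c)).algebraMap_mem k⟩ from rfl] at this
  rw [this]
  exact h.adjoinHom_algebraMap k

/-- `θ` extends `σ`, membership proof irrelevant. [folklore] -/
theorem IsGammaIsoTw₂.coe_fieldEquiv_of_mem_fieldOf (h : IsGammaIsoTw₂ σ c c') {k : F₁}
    (hk : k ∈ fieldOf K₁) (hk' : k ∈ IntermediateField.adjoin (fieldOf K₁) (allGens c)) :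
    (h.fieldEquiv ⟨k, hk'⟩ : F₂) = σ ⟨k, hk⟩ :=
  h.coe_fieldEquiv_algebraMap ⟨k, hk⟩

/-- `θ (lvGens M c j) = lvGens M c' j`. [folklore] -/
theorem IsGammaIsoTw₂.coe_fieldEquiv_lvGens (h : IsGammaIsoTw₂ σ c c') (M : ℕ) (j : Fin N ⊕ Fin N) :
    (h.fieldEquiv ⟨lvGens M c j, mem_adjoinField_of_mem_adjoin
      (lvAlgebra_le_adjoin_allGens K₁ M c (lvGens_mem_lvAlgebra K₁ M c j))⟩ : F₂) = lvGens M c' j := by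
  rw [h.coe_fieldEquiv_of_mem]
  exact h.adjoinHom_lvGens M j

/-- `θ cᵢ = c'ᵢ`, membership proof irrelevant. [folklore] -/
theorem IsGammaIsoTw₂.coe_fieldEquiv_apply (h : IsGammaIsoTw₂ σ c c') (i : Fin N)
    (hi : c i ∈ IntermediateField.adjoin (fieldOf K₁) (allGens c)) :
    (h.fieldEquiv ⟨c i, hi⟩ : F₂) = c' i := by
  have := h.coe_fieldEquiv_lvGens 0 (Sum.inl i)
  simpa only [lvGens_inl] using this

/-- `θ (exp (cᵢ/M!)) = exp (c'ᵢ/M!)`, membership proof irrelevant. [folklore] -/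
theorem IsGammaIsoTw₂.coe_fieldEquiv_exp_div (h : IsGammaIsoTw₂ σ c c') (M : ℕ) (i : Fin N)
    (hi : exp (c i / (M.factorial : F₁)) ∈ IntermediateField.adjoin (fieldOf K₁) (allGens c)) :
    (h.fieldEquiv ⟨exp (c i / (M.factorial : F₁)), hi⟩ : F₂) = exp (c' i / (M.factorial : F₂)) := by
  have := h.coe_fieldEquiv_lvGens M (Sum.inr i)
  simpa only [lvGens_inr] using this

/-! ### `θ` is an isomorphism of Γ-fields (when `σ` is) -/

/-- **`θ` is an isomorphism of Γ-fields over `σ`**: if `σ` is an isomorphism of base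
Γ-fields, then for `x ∈ K₁ + ℚc`, `θ x ∈ K₂ + ℚc'` and `θ (exp x) = exp (θ x)`.
[cite: BaysKirby2018ANT, Def. 3.10] -/
theorem IsGammaIsoTw₂.fieldEquiv_exp (h : IsGammaIsoTw₂ σ c c') (hσ : IsEBaseIso₂ K₁ K₂ σ) {x : F₁}
    (hx : x ∈ K₁ ⊔ Submodule.span ℚ (range c)) :
    (h.fieldEquiv ⟨x, mem_adjoinField_of_mem_adjoin (mem_adjoin_allGens_of_mem hx)⟩ : F₂) ∈
        K₂ ⊔ Submodule.span ℚ (range c') ∧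
      (h.fieldEquiv ⟨exp x, exp_mem_adjoinField_of_mem hx⟩ : F₂) =
        exp (h.fieldEquiv ⟨x, mem_adjoinField_of_mem_adjoin (mem_adjoin_allGens_of_mem hx)⟩ : F₂) :=
  by
  classical
  let E := IntermediateField.adjoin (fieldOf K₁) (allGens c)
  let E' := IntermediateField.adjoin (fieldOf K₂) (allGens c')
  let φ : E →+* F₂ := (algebraMap E' F₂).comp (h.fieldEquiv : E →+* E')
  let Good : F₁ → Prop := fun x => ∃ (hx : x ∈ E) (hex : exp x ∈ E),
    φ ⟨x, hx⟩ ∈ K₂ ⊔ Submodule.span ℚ (range c') ∧ φ ⟨exp x, hex⟩ = exp (φ ⟨x, hx⟩)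
  have good_add : ∀ a b, Good a → Good b → Good (a + b) := by
    rintro a b ⟨ha, hea, ha1, ha2⟩ ⟨hb, heb, hb1, hb2⟩
    have hab : exp (a + b) ∈ E := by rw [exp_add]; exact mul_mem hea heb
    refine ⟨add_mem ha hb, hab, ?_, ?_⟩
    · have : (⟨a + b, add_mem ha hb⟩ : E) = ⟨a, ha⟩ + ⟨b, hb⟩ := rfl
      rw [this, map_add]
      exact add_mem ha1 hb1
    · have e1 : (⟨exp (a + b), hab⟩ : E) = ⟨exp a, hea⟩ * ⟨exp b, heb⟩ := Subtype.ext (exp_add a b)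
      have e2 : (⟨a + b, add_mem ha hb⟩ : E) = ⟨a, ha⟩ + ⟨b, hb⟩ := rfl
      rw [e1, map_mul, e2, map_add, ha2, hb2, exp_add]
  have good_base : ∀ k ∈ K₁, Good k := by
    intro k hk
    have h1 : φ ⟨k, mem_adjoinField_of_mem_adjoin (mem_adjoin_allGens_of_mem_base c hk)⟩ =
        σ ⟨k, mem_fieldOf_of_mem hk⟩ :=
      h.coe_fieldEquiv_algebraMap ⟨k, mem_fieldOf_of_mem hk⟩
    have h2 : φ ⟨exp k, mem_adjoinField_of_mem_adjoin (exp_mem_adjoin_allGens_of_mem_base c hk)⟩ =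
        σ ⟨exp k, exp_mem_fieldOf hk⟩ :=
      h.coe_fieldEquiv_algebraMap ⟨exp k, exp_mem_fieldOf hk⟩
    refine ⟨mem_adjoinField_of_mem_adjoin (mem_adjoin_allGens_of_mem_base c hk),
      mem_adjoinField_of_mem_adjoin (exp_mem_adjoin_allGens_of_mem_base c hk), ?_, ?_⟩
    · rw [h1]; exact Submodule.mem_sup_left (hσ.map_mem hk)
    · rw [h1, h2]; exact hσ.map_exp hk
  have good_gen : ∀ (q : ℚ) (i : Fin N), Good ((q : F₁) * c i) := by
    intro q i
    obtain ⟨M, hM⟩ : ∃ M : ℕ, q.den ∣ M.factorial := ⟨q.den, Nat.dvd_factorial q.den_pos le_rfl⟩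
    have hci : c i ∈ E := mem_adjoinField_of_mem_adjoin
      (lvAlgebra_le_adjoin_allGens K₁ 0 c (lvGens_mem_lvAlgebra K₁ 0 c (Sum.inl i)))
    have hgi : exp (c i / (M.factorial : F₁)) ∈ E := mem_adjoinField_of_mem_adjoin
      (lvAlgebra_le_adjoin_allGens K₁ M c (lvGens_mem_lvAlgebra K₁ M c (Sum.inr i)))
    have hθc : φ ⟨c i, hci⟩ = c' i := h.coe_fieldEquiv_apply i hci
    have hθg : φ ⟨exp (c i / (M.factorial : F₁)), hgi⟩ = exp (c' i / (M.factorial : F₂)) :=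
      h.coe_fieldEquiv_exp_div M i hgi
    have hθq : φ (q : E) = q := map_ratCast φ q
    have hxE : (q : F₁) * c i ∈ E :=
      mem_adjoinField_of_mem_adjoin (ratCast_mul_mem_adjoin_allGens K₁ c q i)
    have hexE : exp ((q : F₁) * c i) ∈ E := exp_ratCast_mul_mem_adjoinField K₁ c q i
    have e1 : (⟨(q : F₁) * c i, hxE⟩ : E) = (q : E) * ⟨c i, hci⟩ := Subtype.ext rfl
    have e2 : (⟨exp ((q : F₁) * c i), hexE⟩ : E) =
        ⟨exp (c i / (M.factorial : F₁)), hgi⟩ ^ (q.num * ((M.factorial / q.den : ℕ) : ℤ)) := by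
      apply (algebraMap E F₁).injective
      rw [map_zpow₀]
      show exp ((q : F₁) * c i) = exp (c i / (M.factorial : F₁)) ^ _
      rw [← Rat.smul_def, exp_rat_smul_eq_zpow q (c i) hM]
    refine ⟨hxE, hexE, ?_, ?_⟩
    · rw [e1, map_mul, hθq, hθc, ← Rat.smul_def]
      exact Submodule.mem_sup_right
        (Submodule.smul_mem _ _ (Submodule.subset_span (mem_range_self i)))
    · rw [e1, e2, map_mul, map_zpow₀, hθq, hθc, hθg, ← exp_rat_smul_eq_zpow q (c' i) hM,
        Rat.smul_def]
  have hgood : Good x := by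
    obtain ⟨k, hk, y, hy, rfl⟩ := Submodule.mem_sup.1 hx
    refine good_add _ _ (good_base k hk) ?_
    obtain ⟨f, rfl⟩ := (Submodule.mem_span_range_iff_exists_fun ℚ).1 hy
    refine Finset.sum_induction _ Good good_add (good_base 0 K₁.zero_mem) ?_
    intro i _
    rw [Rat.smul_def]
    exact good_gen (f i) i
  obtain ⟨_, _, h1, h2⟩ := hgood
  exact ⟨h1, h2⟩

/-- `θ` maps `K₁ + ℚc` into `K₂ + ℚc'`, membership proof irrelevant. [folklore] -/
theorem IsGammaIsoTw₂.coe_fieldEquiv_mem_sup (h : IsGammaIsoTw₂ σ c c') (hσ : IsEBaseIso₂ K₁ K₂ σ)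
    {x : F₁} (hx : x ∈ K₁ ⊔ Submodule.span ℚ (range c))
    (hx' : x ∈ IntermediateField.adjoin (fieldOf K₁) (allGens c)) :
    (h.fieldEquiv ⟨x, hx'⟩ : F₂) ∈ K₂ ⊔ Submodule.span ℚ (range c') :=
  (h.fieldEquiv_exp hσ hx).1

/-- `θ (exp x) = exp (θ x)` on `K₁ + ℚc`, membership proofs irrelevant. [folklore] -/
theorem IsGammaIsoTw₂.coe_fieldEquiv_exp_apply (h : IsGammaIsoTw₂ σ c c') (hσ : IsEBaseIso₂ K₁ K₂ σ)
    {x : F₁} (hx : x ∈ K₁ ⊔ Submodule.span ℚ (range c))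
    (hx' : x ∈ IntermediateField.adjoin (fieldOf K₁) (allGens c))
    (hex : exp x ∈ IntermediateField.adjoin (fieldOf K₁) (allGens c)) :
    (h.fieldEquiv ⟨exp x, hex⟩ : F₂) = exp (h.fieldEquiv ⟨x, hx'⟩ : F₂) :=
  (h.fieldEquiv_exp hσ hx).2

/-! ### Conversely: embeddings extending `σ` give cross Γ-isomorphisms -/

/-- **An embedding of Γ-fields extending `σ` with `c ↦ c'` is a cross Γ-isomorphism.** If
`θ : ⟨K₁ c⟩ → F₂` is a field embedding which is `σ` on `K₁⁰`, sends `cᵢ ↦ c'ᵢ` and satisfies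
`θ (exp x) = exp (θ x)` for `x ∈ K₁ + ℚc`, then `IsGammaIsoTw₂ σ c c'`.
[cite: BaysKirby2018ANT, Def. 3.10] -/
theorem isGammaIsoTw₂_of_ringHom (θ : IntermediateField.adjoin (fieldOf K₁) (allGens c) →+* F₂)
    (hK : ∀ k : fieldOf K₁,
      θ ⟨k, (IntermediateField.adjoin (fieldOf K₁) (allGens c)).algebraMap_mem k⟩ = σ k)
    (hc : ∀ i, θ ⟨c i, mem_adjoinField_of_mem_adjoin
      (lvAlgebra_le_adjoin_allGens K₁ 0 c (lvGens_mem_lvAlgebra K₁ 0 c (Sum.inl i)))⟩ = c' i)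
    (hexp : ∀ (x : F₁) (hx : x ∈ K₁ ⊔ Submodule.span ℚ (range c)),
      θ ⟨exp x, exp_mem_adjoinField_of_mem hx⟩ =
        exp (θ ⟨x, mem_adjoinField_of_mem_adjoin (mem_adjoin_allGens_of_mem hx)⟩)) :
    IsGammaIsoTw₂ σ c c' := by
  classical
  let E := IntermediateField.adjoin (fieldOf K₁) (allGens c)
  intro M
  have hmem : ∀ P : MvPolynomial (Fin N ⊕ Fin N) (fieldOf K₁),
      MvPolynomial.aeval (lvGens M c) P ∈ E := fun P =>
    mem_adjoinField_of_mem_adjoin (lvAlgebra_le_adjoin_allGens K₁ M c (aeval_mem_adjoin_range _ P))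
  -- the two ring homomorphisms `K₁⁰[X] → F₂`
  let ψ₁ : MvPolynomial (Fin N ⊕ Fin N) (fieldOf K₁) →+* F₂ :=
    θ.comp (((MvPolynomial.aeval (lvGens M c)).codRestrict E.toSubalgebra hmem) :
      MvPolynomial (Fin N ⊕ Fin N) (fieldOf K₁) →+* E.toSubalgebra)
  let ψ₂ : MvPolynomial (Fin N ⊕ Fin N) (fieldOf K₁) →+* F₂ :=
    (MvPolynomial.aeval (lvGens M c')).toRingHom.comp
      (MvPolynomial.map (σ : fieldOf K₁ →+* fieldOf K₂))
  have hψ : ψ₁ = ψ₂ := by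
    refine MvPolynomial.ringHom_ext (fun k => ?_) (fun j => ?_)
    · have e1 : ψ₁ (MvPolynomial.C k) = θ ⟨k, E.algebraMap_mem k⟩ := by
        show θ _ = θ _
        congr 1
        exact Subtype.ext (MvPolynomial.aeval_C _ k)
      rw [e1, hK]
      simp [ψ₂]
    · have e1 : ψ₁ (MvPolynomial.X j) = θ ⟨lvGens M c j, mem_adjoinField_of_mem_adjoin
          (lvAlgebra_le_adjoin_allGens K₁ M c (lvGens_mem_lvAlgebra K₁ M c j))⟩ := by
        show θ _ = θ _
        congr 1
        exact Subtype.ext (MvPolynomial.aeval_X _ j)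
      have e2 : ψ₂ (MvPolynomial.X j) = lvGens M c' j := by simp [ψ₂]
      rw [e1, e2]
      cases j with
      | inl i => simpa only [lvGens_inl] using hc i
      | inr i =>
        simp only [lvGens_inr]
        have hci : c i ∈ E := mem_adjoinField_of_mem_adjoin
          (lvAlgebra_le_adjoin_allGens K₁ 0 c (lvGens_mem_lvAlgebra K₁ 0 c (Sum.inl i)))
        have hdiv : c i / (M.factorial : F₁) ∈ K₁ ⊔ Submodule.span ℚ (range c) :=
          div_factorial_mem_sup_span K₁ c M i
        have h2 := hexp _ hdiv
        have h3 : (⟨c i / (M.factorial : F₁), mem_adjoinField_of_mem_adjoin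
            (mem_adjoin_allGens_of_mem hdiv)⟩ : E) = ⟨c i, hci⟩ / (M.factorial : E) :=
          Subtype.ext rfl
        rw [h3, map_div₀, map_natCast, hc i] at h2
        exact h2
  intro P
  have key : θ ⟨MvPolynomial.aeval (lvGens M c) P, hmem P⟩ =
      MvPolynomial.aeval (lvGens M c') (MvPolynomial.map (σ : fieldOf K₁ →+* fieldOf K₂) P) := by
    have := congrArg (fun ψ => ψ P) hψ
    exact this
  rw [← key, map_eq_zero_iff θ θ.injective]
  exact ⟨fun h0 => Subtype.ext h0, fun h0 => congrArg Subtype.val h0⟩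

/-- **Faithfulness of `GammaField.IsGammaIsoTw₂`.** For an isomorphism `σ` of base Γ-fields,
`IsGammaIsoTw₂ σ c c'` holds iff there is a field isomorphism `θ : ⟨K₁ c⟩ ≅ ⟨K₂ c'⟩` (a subfield
of `F₁` onto a subfield of `F₂`) extending `σ`, sending `cᵢ ↦ c'ᵢ`, mapping `K₁ + ℚc` into
`K₂ + ℚc'` and commuting with `exp` there — an isomorphism of Γ-fields over `σ` (Bays–Kirby
2018, Def. 3.10). [cite: BaysKirby2018ANT, Def. 3.10, Def. 3.15] -/
theorem isGammaIsoTw₂_iff_exists_ringEquiv (hσ : IsEBaseIso₂ K₁ K₂ σ) : IsGammaIsoTw₂ σ c c' ↔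
    ∃ θ : IntermediateField.adjoin (fieldOf K₁) (allGens c) ≃+*
        IntermediateField.adjoin (fieldOf K₂) (allGens c'),
      (∀ k : fieldOf K₁,
        (θ ⟨k, (IntermediateField.adjoin (fieldOf K₁) (allGens c)).algebraMap_mem k⟩ : F₂) = σ k) ∧
      (∀ i, (θ ⟨c i, mem_adjoinField_of_mem_adjoin
        (lvAlgebra_le_adjoin_allGens K₁ 0 c (lvGens_mem_lvAlgebra K₁ 0 c (Sum.inl i)))⟩ : F₂) =
          c' i) ∧
      ∀ (x : F₁) (hx : x ∈ K₁ ⊔ Submodule.span ℚ (range c)),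
        (θ ⟨x, mem_adjoinField_of_mem_adjoin (mem_adjoin_allGens_of_mem hx)⟩ : F₂) ∈
            K₂ ⊔ Submodule.span ℚ (range c') ∧
          (θ ⟨exp x, exp_mem_adjoinField_of_mem hx⟩ : F₂) =
            exp (θ ⟨x, mem_adjoinField_of_mem_adjoin (mem_adjoin_allGens_of_mem hx)⟩ : F₂) := by
  constructor
  · intro h
    exact ⟨h.fieldEquiv, h.coe_fieldEquiv_algebraMap, fun i => h.coe_fieldEquiv_apply i _,
      fun x hx => h.fieldEquiv_exp hσ hx⟩
  · rintro ⟨θ, hK, hc, hexp⟩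
    exact isGammaIsoTw₂_of_ringHom
      ((algebraMap (IntermediateField.adjoin (fieldOf K₂) (allGens c')) F₂).comp θ.toRingHom)
      hK hc fun x hx => (hexp x hx).2

/-! ### Uniqueness of the field isomorphism -/

/-- **The field isomorphism is determined by `σ` and `c ↦ c'`**: any ring homomorphism
`⟨K₁ c⟩ → F₂` which is `σ` on `K₁⁰` and maps `lvGens M c ↦ lvGens M c'` for all `M` agrees with
`θ`. [folklore] -/
theorem IsGammaIsoTw₂.ringHom_eq_fieldEquiv (h : IsGammaIsoTw₂ σ c c')
    (θ : IntermediateField.adjoin (fieldOf K₁) (allGens c) →+* F₂)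
    (hK : ∀ k : fieldOf K₁,
      θ ⟨k, (IntermediateField.adjoin (fieldOf K₁) (allGens c)).algebraMap_mem k⟩ = σ k)
    (hgen : ∀ M j, θ ⟨lvGens M c j, mem_adjoinField_of_mem_adjoin
      (lvAlgebra_le_adjoin_allGens K₁ M c (lvGens_mem_lvAlgebra K₁ M c j))⟩ = lvGens M c' j)
    (x : IntermediateField.adjoin (fieldOf K₁) (allGens c)) : θ x = h.fieldEquiv x := by
  let E := IntermediateField.adjoin (fieldOf K₁) (allGens c)
  let θ' : E →+* F₂ :=
    (algebraMap (IntermediateField.adjoin (fieldOf K₂) (allGens c')) F₂).comp h.fieldEquiv.toRingHom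
  have hS : ∀ y ∈ allGens c, ∀ hy : y ∈ E, θ ⟨y, hy⟩ = θ' ⟨y, hy⟩ := by
    intro y hy hyE
    obtain ⟨M, hM⟩ := mem_iUnion.1 hy
    obtain ⟨j, rfl⟩ := hM
    rw [hgen M j]
    exact (h.coe_fieldEquiv_lvGens M j).symm
  have hB : ∀ k : fieldOf K₁, θ ⟨k, E.algebraMap_mem k⟩ = θ' ⟨k, E.algebraMap_mem k⟩ := by
    intro k
    rw [hK k]
    exact (h.coe_fieldEquiv_algebraMap k).symm
  suffices hx : ∀ (y : F₁) (hy : y ∈ E), θ ⟨y, hy⟩ = θ' ⟨y, hy⟩ from hx x x.2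
  intro y hy
  induction hy using IntermediateField.adjoin_induction with
  | mem y hy => exact hS y hy _
  | algebraMap k => exact hB k
  | add y z hy hz ihy ihz =>
    have e : (⟨y + z, add_mem hy hz⟩ : E) = ⟨y, hy⟩ + ⟨z, hz⟩ := rfl
    rw [e, map_add, map_add, ihy, ihz]
  | inv y hy ihy =>
    have e : (⟨y⁻¹, inv_mem hy⟩ : E) = (⟨y, hy⟩ : E)⁻¹ := rfl
    rw [e, map_inv₀, map_inv₀, ihy]
  | mul y z hy hz ihy ihz =>
    have e : (⟨y * z, mul_mem hy hz⟩ : E) = ⟨y, hy⟩ * ⟨z, hz⟩ := rfl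
    rw [e, map_mul, map_mul, ihy, ihz]

end Faithfulness

end GammaField

end Literature.NumberTheory.Transcendental
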